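import Summits.BirchSwinnertonDyer.BirchSwinnertonDyer.Theorems.TwoAdicConverseMultEisensteinWeak
import Summits.BirchSwinnertonDyer.BirchSwinnertonDyer.Theorems.TwoAdicConverseMultLambdaRoad
import Summits.BirchSwinnertonDyer.Rank1Residual.X5.TwoAdicTargetsMultPubOdd
import Summits.BirchSwinnertonDyer.Rank1Residual.X5.TwoAdicTargetsMultDoorsTwinA
import HarnessLib

/-!
# Route `TwoAdicConverse` (rung S3), crux `MultiplicativeRankZeroTwoConverse` (item
# stmt-BirchSwinnertonDyer-19219): the three CYCLOTOMIC bridges to the crux with the PRINT binder `h41ns`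
# RE-TYPED to the guarded twin of Greenberg's multiplicative display (D-audit h41 remedy N-1(b))

Cell `bsd-2adic`, seat `bsd-2adic-conv-2` GEN 4. THEOREMS ONLY — nothing asserted, no definition, no named
fact, no class booked. PARTITION (D-0054): none — RANK axis (S3 mult); companion formula cell X5@2 mult
(K4ᵐ, B1·O1; 1 976 book230 classes).

WHY THIS FILE EXISTS. The D-audit of the multiplicative PRINT binder `h41`/`h41ns`
(`HOME/audit/D-AUDIT-h41-Gr99-Thm41-mult-analogue-at-2.md` @f526883ecb786716, seat bsd-2adic-audit-1,
2026-08-26) found that the parity-free transcription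
`Greenberg1999.thm41Analogue_charValue_rankZero_numberField_anyPrime` (cell registry A235), read as a
`∀`-number-field `Prop`, is CONTRADICTED on print's own §3-Note sub-case (a place `v ∣ 2` of even local
degree), so a theorem displaying `(h41ns : A235)` carries a false hypothesis and prices nothing. The
literature seat landed the GUARDED twin
`Greenberg1999.thm41Analogue_charValue_rankZero_numberField_anyPrime_oddLocalDegree` (p425330; its `F = ℚ`
projection is identical to A235's), seat mult-3 landed the primed O1 glue
`X5.O1.twoAdicEulerCharRankZeroNonsplitMult_zero_of_greenberg'` (p428013) and seat mult GEN 7 the primed door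
`X5.O1.analyticRank_eq_zero_of_finite_selmer_nonsplit_two'` (`X5/TwoAdicTargetsMultDoorsTwinA.lean`). The
S3ᵐ bridges that display `h41ns` are THIS seat's (mult-3, INBOX 2026-08-26T06:33:16Z: «N-1(b) for YOUR
A235-takers»): `multiplicativeRankZeroTwoConverse_of_multEisenstein` (p418740, + its non-split per-curve
theorem), `…_of_multEisenstein_finiteSel{,_upToIsogeny}` (p424488), `…_of_lambdaPart` (p419187) and the
cyclotomic bridge `…_of_multLowerRat` of `TwoAdicConverseMultiplicativeInputs.lean` (p411646, seat mult GEN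
4, which serves 19219). Each theorem below is the tree theorem of the same name WITHOUT the prime, with
(i) the binder `h41ns` re-typed to the twin, (ii) the glue / per-curve theorem / door replaced by its primed
version — hypotheses otherwise and conclusions BYTE-IDENTICAL. The split-multiplicative binder `h41sp`
(A236) PASSED the audit (V3) and is untouched. In addition the non-split per-curve theorem is given in
DOOR-VALUE form (`…_of_eulerChar`: hypothesis the O1 target `TwoAdicEulerCharRankZeroNonsplitMult W 0`
itself), so that no future re-reading of Greenberg's display touches it again. LEAF module: the unprimed
files and their importers are untouched (append-only tree, no rebuild cascade).

Sources: Greenberg, LNM 1716 (1999) §4 pp. 112–113 ("the analogue of theorem 4.1"; held copy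
`book:coates1999-arithmetic-theory-elliptic-curves` chunks p0112–p0113); Mazur–Tate–Teitelbaum, Invent.
math. 84 (1986) §I.14, §II.10; Kato, Astérisque 295 (2004) Thm. 17.4 / 17.13 (shape of K11; good ordinary
in print, Prop. 17.1); Greenberg–Vatsal, Invent. math. 142 (2000) p. 4; the memos of record named in the
unprimed theorems' docstrings (HOME/mult/PROOF-MULT.md = K11, PROOF-GS2.md = Greenberg–Stevens at `2`).
-/

set_option linter.dupNamespace false
set_option autoImplicit false

noncomputable section

open scoped Classical MatrixGroups ModularForm

open CongruenceSubgroup WeierstrassCurve Literature.NumberTheory.EllipticCurves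
  Literature.NumberTheory.EllipticCurves.ModularForms
  Literature.NumberTheory.EllipticCurves.Greenberg1999
  Literature.NumberTheory.EllipticCurves.Rank1Residual
  Literature.NumberTheory.EllipticCurves.Rank1Residual.Typed
  Summit.BirchSwinnertonDyer.Rank1Residual.X1.MuLambda
  Summit.BirchSwinnertonDyer.Rank1Residual.X5
  Summit.BirchSwinnertonDyer.Rank1Residual.X5.O1
  Summit.BirchSwinnertonDyer.BirchSwinnertonDyer.Theses.TwoAdicConverse

namespace Summit.BirchSwinnertonDyer.BirchSwinnertonDyer.Theorems

/-! ## §1 The non-split per-curve theorem in DOOR-VALUE form and its primed twin -/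

section PerCurve

variable (W : WeierstrassCurve ℚ) [W.IsElliptic] [W.IsGloballyMinimal]

/-- **Rank-`0` `2`-converse at a NON-SPLIT multiplicative `2` from T-mult-4-int, DOOR-VALUE form.** As
`analyticRank_eq_zero_of_finite_selmer_nonsplit_two_of_multEisenstein` (p418740) with Greenberg's non-split
display consumed as the O1 target VALUE `hEC : TwoAdicEulerCharRankZeroNonsplitMult W 0` (however it is
supplied: A235, its guarded twin, or a future proof) instead of a named reading. Inputs otherwise unchanged:
modularity (`hmod`, also the rational period ratio `ϖ`), «`X(E/ℚ_∞)` is `Λ`-torsion» (`hX`), and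
`O1.MultEisensteinDivisibilityAtTwo W` (T-mult-4-int). If `Sel_{2^∞}(E/ℚ)` is finite then `L(E,1) ≠ 0` and
`r_an(E) = 0`: `hEC` gives `f_X(0) ≠ 0`, T-mult-4-int gives `f_X(0) = h(0)·ϖ·(2·[0]⁺_f)`, so `[0]⁺_f ≠ 0`.
Proof = p418740's, one line shorter. [cite: GreenbergLNM1716, §4 pp. 112–113]
[cite: MazurTateTeitelbaum1986Invent, §I.14 (L(0) = (1 − α⁻¹)[0]⁺, α = −1)] -/
theorem analyticRank_eq_zero_of_finite_selmer_nonsplit_two_of_multEisenstein_of_eulerChar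
    (hEC : TwoAdicEulerCharRankZeroNonsplitMult W 0)
    (hmod : nonempty_modularParametrizationData)
    (hX : ∀ (κ : ZpExtension ℚ 2) (γ : Field.absoluteGaloisGroup ℚ), κ.IsCyclotomic →
      κ.IsTopGenerator γ → IsCyclotomicVariable 2 γ → ∀ D : W.SelmerDualData κ γ, D.IsTorsion)
    (hEis : MultEisensteinDivisibilityAtTwo W)
    (hmult : Mult W 2) (hns : ¬ W.HasSplitMultiplicativeReductionAtPrime 2)
    (hfin : Finite (W.selmerGroupPInfty 2)) :
    W.entireLFunction 1 ≠ 0 ∧ W.analyticRank = 0 := by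
  haveI : NeZero (W.conductorNorm ℤ) := ⟨(W.conductorNorm_pos_holds).ne'⟩
  obtain ⟨Dm⟩ := hmod W
  have hf : IsNewformOf W Dm.f := Dm.isNewformOf
  obtain ⟨ϖ, hϖpos, hϖ, -⟩ := Dm.exists_rat_mul_realPeriodRat_eq_plusPeriod
  obtain ⟨κ, hκ, γ, hγ, hγ'⟩ := exists_isCyclotomic_isTopGenerator_isCyclotomicVariable_holds 2
  obtain ⟨D⟩ := W.nonempty_selmerDualData_holds κ γ hγ
  obtain ⟨L, hL⟩ := exists_isMultPAdicLFunctionOf_neg_one_of_nonsplit (p := 2) hf hmult hns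
  have hXD : D.IsTorsion := hX κ γ hκ hγ hγ' D
  haveI : Module.Finite (IwasawaAlgebra 2) D.X := D.module_finite_holds hγ
  haveI : (Module.charIdeal (IwasawaAlgebra 2) D.X).IsPrincipal := charIdeal_isPrincipal_holds 2 D.X
  obtain ⟨fE, hchar⟩ := Submodule.IsPrincipal.principal (Module.charIdeal (IwasawaAlgebra 2) D.X)
  have hchar' : D.charIdeal = Ideal.span {fE} := hchar
  -- Greenberg's non-split display at `2` (value): `f_E(0) ≠ 0` since `Sel` is finite
  obtain ⟨u, hu⟩ := hEC hmult hns κ γ hκ hγ hγ' D hXD fE hchar' hfin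
  have hcard : (Nat.card (W.selmerGroupPInfty 2) : ℚ_[2]) ≠ 0 := by
    haveI := hfin
    exact_mod_cast (Nat.card_pos (α := W.selmerGroupPInfty 2)).ne'
  have hfE0 : ((PowerSeries.constantCoeff fE : ℤ_[2]) : ℚ_[2]) ≠ 0 := by
    intro h0
    rw [h0, zero_mul] at hu
    exact (mul_ne_zero (mul_ne_zero (coe_units_ne_zero 2 u) (zpow_ne_zero _ two_ne_zero)) hcard)
      hu.symm
  -- T-mult-4-int, non-split clause at `(Dm.f, ϖ)`: `ι f_E = ι h · (ϖ · L)`, constant coefficients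
  obtain ⟨hns', -⟩ := hEis κ γ hκ hγ hγ' hmult Dm.f hf ϖ hϖ D fE hchar'
  obtain ⟨h, hdiv⟩ := hns' hns L hL
  have h0 := congrArg PowerSeries.constantCoeff hdiv
  rw [map_mul, map_mul, PowerSeries.constantCoeff_C, constantCoeff_iwasawaToPowerSeries,
    constantCoeff_iwasawaToPowerSeries, hL.constantCoeff_of_neg_one] at h0
  -- `f_E(0) = h(0) · (ϖ · (2 · [0]⁺_f))`, so `[0]⁺_f ≠ 0`
  have hs0 : (ratPlusSymbol Dm.f 0 : ℚ_[2]) ≠ 0 := by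
    intro hz
    rw [hz, mul_zero, mul_zero, mul_zero] at h0
    exact hfE0 h0
  have hs0' : ratPlusSymbol Dm.f 0 ≠ 0 := by exact_mod_cast hs0
  have hL1 : W.entireLFunction 1 ≠ 0 := (ratPlusSymbol_zero_ne_zero_iff W hf).mp hs0'
  exact ⟨hL1, (W.analyticRank_eq_zero_iff_holds hf.hasEntireLFunction).mpr hL1⟩

/-- **PRIMED (D-audit h41, N-1(b)): `analyticRank_eq_zero_of_finite_selmer_nonsplit_two_of_multEisenstein`
with the PRINT binder `h41` re-typed from A235 to its GUARDED twin
`Greenberg1999.thm41Analogue_charValue_rankZero_numberField_anyPrime_oddLocalDegree` (p425330); statement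
otherwise and conclusion byte-identical; the display is read through the primed glue
`twoAdicEulerCharRankZeroNonsplitMult_zero_of_greenberg'` (p428013).** Non-split multiplicative `2`:
`Sel_{2^∞}(E/ℚ)` finite ⇒ `L(E,1) ≠ 0 ∧ r_an(E) = 0` ⟸ PRINT {twin `h41`, modularity} + «`X` torsion» +
T-mult-4-int. [cite: GreenbergLNM1716, §4 pp. 112–113]
[cite: MazurTateTeitelbaum1986Invent, §I.14 (L(0) = (1 − α⁻¹)[0]⁺, α = −1)] -/
theorem analyticRank_eq_zero_of_finite_selmer_nonsplit_two_of_multEisenstein'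
    (h41 : thm41Analogue_charValue_rankZero_numberField_anyPrime_oddLocalDegree)
    (hmod : nonempty_modularParametrizationData)
    (hX : ∀ (κ : ZpExtension ℚ 2) (γ : Field.absoluteGaloisGroup ℚ), κ.IsCyclotomic →
      κ.IsTopGenerator γ → IsCyclotomicVariable 2 γ → ∀ D : W.SelmerDualData κ γ, D.IsTorsion)
    (hEis : MultEisensteinDivisibilityAtTwo W)
    (hmult : Mult W 2) (hns : ¬ W.HasSplitMultiplicativeReductionAtPrime 2)
    (hfin : Finite (W.selmerGroupPInfty 2)) :
    W.entireLFunction 1 ≠ 0 ∧ W.analyticRank = 0 :=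
  analyticRank_eq_zero_of_finite_selmer_nonsplit_two_of_multEisenstein_of_eulerChar W
    (twoAdicEulerCharRankZeroNonsplitMult_zero_of_greenberg' W h41) hmod hX hEis hmult hns hfin

end PerCurve

/-! ## §2 The ∀-closed bridges, primed -/

/-- **PRIMED (D-audit h41, N-1(b)): `multiplicativeRankZeroTwoConverse_of_multEisenstein` (p418740) with
`h41ns` re-typed to the guarded twin; conclusion byte-identical.** PRINT {twin `h41ns`, A236 `h41sp`,
modularity `hmod`} + MEMO {K11 `hKato` (used ONLY for «`X` torsion»), Greenberg–Stevens at `2` `hGS`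
(split case)} + the ONE ∀-closed research object `hEis : ∀ non-CM W multiplicative at 2,
X5.O1.MultEisensteinDivisibilityAtTwo W` (T-mult-4-int) ⟹ `MultiplicativeRankZeroTwoConverse`.
[cite: GreenbergLNM1716, §4 pp. 112–113] [cite: MazurTateTeitelbaum1986Invent, §I.14]
[cite: Kato2004Asterisque, Thm 17.4 and 17.13 (shape; p ∤ N in print)] -/
theorem multiplicativeRankZeroTwoConverse_of_multEisenstein'
    (h41ns : thm41Analogue_charValue_rankZero_numberField_anyPrime_oddLocalDegree)
    (h41sp : thm41Analogue_charValue_rankZero_split_baseChange_anyPrime)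
    (hmod : nonempty_modularParametrizationData)
    (hKato : ∀ (W : WeierstrassCurve ℚ) [W.IsElliptic] [W.IsGloballyMinimal],
      ¬ W.HasCM → Mult W 2 → KatoMultiplicativeDivisibilityRat W 2)
    (hGS : ∀ (W : WeierstrassCurve ℚ) [W.IsElliptic] [W.IsGloballyMinimal],
      W.HasSplitMultiplicativeReductionAtPrime 2 → greenberg_stevens (W := W) (p := 2))
    (hEis : ∀ (W : WeierstrassCurve ℚ) [W.IsElliptic] [W.IsGloballyMinimal],
      ¬ W.HasCM → Mult W 2 → MultEisensteinDivisibilityAtTwo W) :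
    MultiplicativeRankZeroTwoConverse := by
  unfold MultiplicativeRankZeroTwoConverse
  intro W _ _ hcm hmult hsel
  haveI : Fact (Nat.Prime 2) := ⟨Nat.prime_two⟩
  have hfin : Finite (W.selmerGroupPInfty 2) :=
    (finite_selmerGroupPInfty_iff_selmerCorank_eq_zero W 2).mpr hsel
  have hX := isTorsion_of_katoMultiplicativeDivisibilityRat W hmod (hKato W hcm hmult) hmult
  by_cases hsp : W.HasSplitMultiplicativeReductionAtPrime 2
  · exact (analyticRank_eq_zero_of_finite_selmer_split_two_of_multEisenstein W (hGS W hsp) h41sp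
      hmod hX (hEis W hcm hmult) hmult hsp hfin).2
  · exact (analyticRank_eq_zero_of_finite_selmer_nonsplit_two_of_multEisenstein' W h41ns hmod hX
      (hEis W hcm hmult) hmult hsp hfin).2

/-- **PRIMED (D-audit h41, N-1(b)): `multiplicativeRankZeroTwoConverse_of_multEisenstein_finiteSel_upToIsogeny`
(p424488) with `h41ns` re-typed to the guarded twin; conclusion byte-identical.** Cyclotomic road weakened
from the converse side: PRINT + MEMO as above and T-mult-4-int ONLY at curves with `Sel_{2^∞}` FINITE and
only at SOME globally minimal multiplicative-at-`2` `W'` `ℚ`-isogenous to `W` ⟹ the crux (isogeny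
invariance of `corank Sel_{2^∞}` and of `ord_{s=1} L`, tree theorem
`analyticRank_eq_zero_of_isIsogenous_of_selmerCorank_two_eq_zero`).
[cite: GreenbergLNM1716, §4 pp. 112–113 and §1 pp. 54–57] [cite: Knapp1993, Thm. 11.67]
[cite: Kato2004Asterisque, Thm 17.4 (1) and 17.13 (shape)] -/
theorem multiplicativeRankZeroTwoConverse_of_multEisenstein_finiteSel_upToIsogeny'
    (h41ns : thm41Analogue_charValue_rankZero_numberField_anyPrime_oddLocalDegree)
    (h41sp : thm41Analogue_charValue_rankZero_split_baseChange_anyPrime)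
    (hmod : nonempty_modularParametrizationData)
    (hKato : ∀ (W : WeierstrassCurve ℚ) [W.IsElliptic] [W.IsGloballyMinimal],
      ¬ W.HasCM → Mult W 2 → KatoMultiplicativeDivisibilityRat W 2)
    (hGS : ∀ (W : WeierstrassCurve ℚ) [W.IsElliptic] [W.IsGloballyMinimal],
      W.HasSplitMultiplicativeReductionAtPrime 2 → greenberg_stevens (W := W) (p := 2))
    (hE : ∀ (W : WeierstrassCurve ℚ) [W.IsElliptic] [W.IsGloballyMinimal], ¬ W.HasCM → Mult W 2 →
      Finite (W.selmerGroupPInfty 2) →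
        ∃ (W' : WeierstrassCurve ℚ) (_ : W'.IsElliptic) (_ : W'.IsGloballyMinimal),
          IsIsogenous W W' ∧ Mult W' 2 ∧ MultEisensteinDivisibilityAtTwo W') :
    MultiplicativeRankZeroTwoConverse := by
  unfold MultiplicativeRankZeroTwoConverse
  intro W _ _ hcm hmult hsel
  have hSel : Finite (W.selmerGroupPInfty 2) :=
    (finite_selmerGroupPInfty_iff_selmerCorank_eq_zero W 2).2 hsel
  obtain ⟨W', _, _, hiso, hmult', hE'⟩ := hE W hcm hmult hSel
  have hcm' : ¬ W'.HasCM := fun hCM => W'.not_hasMultiplicativeReductionAtPrime_of_hasCM hCM 2 hmult'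
  refine analyticRank_eq_zero_of_isIsogenous_of_selmerCorank_two_eq_zero hiso (fun hsel' ↦ ?_) hsel
  have hfin' : Finite (W'.selmerGroupPInfty 2) :=
    (finite_selmerGroupPInfty_iff_selmerCorank_eq_zero W' 2).2 hsel'
  have hX := isTorsion_of_katoMultiplicativeDivisibilityRat W' hmod (hKato W' hcm' hmult') hmult'
  by_cases hsp : W'.HasSplitMultiplicativeReductionAtPrime 2
  · exact (analyticRank_eq_zero_of_finite_selmer_split_two_of_multEisenstein W' (hGS W' hsp) h41sp
      hmod hX hE' hmult' hsp hfin').2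
  · exact (analyticRank_eq_zero_of_finite_selmer_nonsplit_two_of_multEisenstein' W' h41ns hmod hX hE'
      hmult' hsp hfin').2

/-- **PRIMED (D-audit h41, N-1(b)): `multiplicativeRankZeroTwoConverse_of_multEisenstein_finiteSel`
(p424488) with `h41ns` re-typed to the guarded twin; conclusion byte-identical.** Same model: T-mult-4-int
on the finite-`Sel` locus (`W' = W`). [cite: GreenbergLNM1716, §4 pp. 112–113]
[cite: Kato2004Asterisque, Thm 17.4 (1) (shape)] -/
theorem multiplicativeRankZeroTwoConverse_of_multEisenstein_finiteSel'
    (h41ns : thm41Analogue_charValue_rankZero_numberField_anyPrime_oddLocalDegree)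
    (h41sp : thm41Analogue_charValue_rankZero_split_baseChange_anyPrime)
    (hmod : nonempty_modularParametrizationData)
    (hKato : ∀ (W : WeierstrassCurve ℚ) [W.IsElliptic] [W.IsGloballyMinimal],
      ¬ W.HasCM → Mult W 2 → KatoMultiplicativeDivisibilityRat W 2)
    (hGS : ∀ (W : WeierstrassCurve ℚ) [W.IsElliptic] [W.IsGloballyMinimal],
      W.HasSplitMultiplicativeReductionAtPrime 2 → greenberg_stevens (W := W) (p := 2))
    (hE : ∀ (W : WeierstrassCurve ℚ) [W.IsElliptic] [W.IsGloballyMinimal], ¬ W.HasCM → Mult W 2 →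
      Finite (W.selmerGroupPInfty 2) → MultEisensteinDivisibilityAtTwo W) :
    MultiplicativeRankZeroTwoConverse :=
  multiplicativeRankZeroTwoConverse_of_multEisenstein_finiteSel_upToIsogeny' h41ns h41sp hmod hKato hGS
    fun W _ _ hcm hmult hSel ↦
      ⟨W, inferInstance, inferInstance, isIsogenous_self W, hmult, hE W hcm hmult hSel⟩

/-- **PRIMED (D-audit h41, N-1(b)): `multiplicativeRankZeroTwoConverse_of_multLowerRat` (p411646, seat
bsd-2adic-mult GEN 4; serves item 19219) with `h41ns` re-typed to the guarded twin and the door replaced by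
the primed door `O1.analyticRank_eq_zero_of_finite_selmer_nonsplit_two'` (`X5/TwoAdicTargetsMultDoorsTwinA.lean`);
conclusion byte-identical.** Cyclotomic `⊗ℚ` road: PRINT {twin `h41ns`, A236 `h41sp`, modularity} + MEMO
{Kato `⊗ℚ` at a multiplicative `2` `hKato`, Greenberg–Stevens at `2` `hGS`} + the OPEN lower `⊗ℚ`
divisibility T-mult-4 (`hlow'`, ∀-closed) ⟹ `MultiplicativeRankZeroTwoConverse`.
[cite: GreenbergLNM1716, §4 pp. 112–113] [cite: MazurTateTeitelbaum1986Invent, §I.14]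
[cite: Kato2004Asterisque, Thm 17.4 and 17.13 (shape)] [cite: Kobayashi2006DocMath, Cor 4.2 (shape; odd p)] -/
theorem multiplicativeRankZeroTwoConverse_of_multLowerRat'
    (h41ns : thm41Analogue_charValue_rankZero_numberField_anyPrime_oddLocalDegree)
    (h41sp : thm41Analogue_charValue_rankZero_split_baseChange_anyPrime)
    (hmod : nonempty_modularParametrizationData)
    (hKato : ∀ (W : WeierstrassCurve ℚ) [W.IsElliptic] [W.IsGloballyMinimal],
      ¬ W.HasCM → Mult W 2 → KatoMultiplicativeDivisibilityRat W 2)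
    (hGS : ∀ (W : WeierstrassCurve ℚ) [W.IsElliptic] [W.IsGloballyMinimal],
      W.HasSplitMultiplicativeReductionAtPrime 2 → greenberg_stevens (W := W) (p := 2))
    (hlow' : ∀ (W : WeierstrassCurve ℚ) [W.IsElliptic] [W.IsGloballyMinimal],
      ¬ W.HasCM → Mult W 2 → MultLowerDivisibilityAtTwoRat W) :
    MultiplicativeRankZeroTwoConverse := by
  unfold MultiplicativeRankZeroTwoConverse
  intro W _ _ hcm hmult hsel
  haveI : Fact (Nat.Prime 2) := ⟨Nat.prime_two⟩
  have hfin : Finite (W.selmerGroupPInfty 2) :=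
    (finite_selmerGroupPInfty_iff_selmerCorank_eq_zero W 2).mpr hsel
  by_cases hsp : W.HasSplitMultiplicativeReductionAtPrime 2
  · exact (analyticRank_eq_zero_of_finite_selmer_split_two W (hGS W hsp) h41sp hmod
      (fun f L => katoDivisibilityAtTwoSplitMultRat_of_multRat W (hKato W hcm hmult) f L)
      (hlow' W hcm hmult) hmult hsp hfin).2
  · exact (analyticRank_eq_zero_of_finite_selmer_nonsplit_two' W h41ns hmod
      (fun f L => katoDivisibilityAtTwoNonsplitMultRat_of_multRat W (hKato W hcm hmult) f L)
      (hlow' W hcm hmult) hmult hsp hfin).2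

/-- **PRIMED (D-audit h41, N-1(b)): `multiplicativeRankZeroTwoConverse_of_lambdaPart` (p419187) with
`h41ns` re-typed to the guarded twin; conclusion byte-identical.** λ-road: PRINT {twin `h41ns`, A236
`h41sp`, modularity} + MEMO {Kato `⊗ℚ` at a multiplicative `2` `hKato` (torsion AND the divisibility
`char X ∣ 2ⁿL₂`), Greenberg–Stevens at `2` `hGS`} + the λ-PART ∀-closed over non-CM `E/ℚ` multiplicative
at `2` (`hlam`: «`λ(2ⁿ·L₂(E)) ≤ λ(char X(E/ℚ_∞))`, trivial zero removed») ⟹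
`MultiplicativeRankZeroTwoConverse`; composition of the tree's `⊗ℚ` pinch
`multLowerDivisibilityAtTwoRat_of_katoRat_of_lambdaPart` (p419187 §2) with the primed `⊗ℚ` bridge above.
[cite: GreenbergVatsal2000, p. 4 (after Thm. (1.2))] [cite: GreenbergLNM1716, §4 pp. 112–113]
[cite: Kato2004Asterisque, Thm 17.4 and 17.13 (shape)] [cite: MazurTateTeitelbaum1986Invent, §I.14] -/
theorem multiplicativeRankZeroTwoConverse_of_lambdaPart'
    (h41ns : thm41Analogue_charValue_rankZero_numberField_anyPrime_oddLocalDegree)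
    (h41sp : thm41Analogue_charValue_rankZero_split_baseChange_anyPrime)
    (hmod : nonempty_modularParametrizationData)
    (hKato : ∀ (W : WeierstrassCurve ℚ) [W.IsElliptic] [W.IsGloballyMinimal],
      ¬ W.HasCM → Mult W 2 → KatoMultiplicativeDivisibilityRat W 2)
    (hGS : ∀ (W : WeierstrassCurve ℚ) [W.IsElliptic] [W.IsGloballyMinimal],
      W.HasSplitMultiplicativeReductionAtPrime 2 → greenberg_stevens (W := W) (p := 2))
    (hlam : ∀ (W : WeierstrassCurve ℚ) [W.IsElliptic] [W.IsGloballyMinimal], ¬ W.HasCM → Mult W 2 →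
      ∀ (κ : ZpExtension ℚ 2) (γ : Field.absoluteGaloisGroup ℚ), κ.IsCyclotomic →
      κ.IsTopGenerator γ → IsCyclotomicVariable 2 γ → Mult W 2 →
      ∀ ⦃N : ℕ⦄ [NeZero N] (f : CuspForm (Gamma0 N) 2), IsNewformOf W f →
      ∀ (D : W.SelmerDualData κ γ) (g h : IwasawaAlgebra 2) (n : ℕ),
        D.charIdeal = Ideal.span {g} →
        (¬ W.HasSplitMultiplicativeReductionAtPrime 2 →
          ∀ L : PowerSeries ℚ_[2], IsMultPAdicLFunctionOf f 2 (-1) L →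
            iwasawaToPowerSeries 2 (g * h) = PowerSeries.C ((2 : ℚ_[2]) ^ n) * L →
            g * h ≠ 0 ∧ lam (g * h) ≤ lam g) ∧
        (W.HasSplitMultiplicativeReductionAtPrime 2 →
          ∀ L : PowerSeries ℚ_[2], IsSplitMultPAdicLFunctionOf f 2 L →
            iwasawaToPowerSeries 2 (PowerSeries.X * (g * h)) = PowerSeries.C ((2 : ℚ_[2]) ^ n) * L →
            g * h ≠ 0 ∧ lam (g * h) ≤ lam g)) :
    MultiplicativeRankZeroTwoConverse :=
  multiplicativeRankZeroTwoConverse_of_multLowerRat' h41ns h41sp hmod hKato hGS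
    (fun W _ _ hcm hmult =>
      multLowerDivisibilityAtTwoRat_of_katoRat_of_lambdaPart W (hKato W hcm hmult) (hlam W hcm hmult))

end Summit.BirchSwinnertonDyer.BirchSwinnertonDyer.Theorems

end
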